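import Summits.BirchSwinnertonDyer.BirchSwinnertonDyer.Theorems.GenusKolyvaginAtTwoPowDvdShaCardAtTwoRTLadderFrameBookkeeping
import Summits.BirchSwinnertonDyer.BirchSwinnertonDyer.Theorems.GenusKolyvaginAtTwoPowDvdShaCardAtTwoRTRelaxedShaGenusBudget
import Summits.BirchSwinnertonDyer.BirchSwinnertonDyer.Theorems.GenusKolyvaginAtTwoCasselsTateNumberField
import Summits.BirchSwinnertonDyer.BirchSwinnertonDyer.Theorems.AdditiveBranchIMCGenusGrossZagierHeegnerOne
import Literature.NumberTheory.EllipticCurves.SzpiroOfAbcProofs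
import HarnessLib

/-!
# Route `GenusKolyvaginAtTwo`, LINE 18 (L_T `PowDvdShaCardAtTwoRT`, stmt-BirchSwinnertonDyer-23242), stub 3a‴ `stub_twinLadderGenus`
# — THE FRAME THEOREM: 3a‴'s inequality from the two ℚ-side ladders of Kolyvagin classes (2/2)

Seat `bsd-line-gk2-p3` g18 (cell `bsd-f1-sign2`), `--supports stmt-BirchSwinnertonDyer-23242` (helper; closes nothing).
THEOREMS ONLY (no definition, no named fact, no `sorry`); BSD is not proved by any of this.

WHAT.  On the LINE 18 frame (`W/ℚ` globally minimal, `Δ_W < 0`, `C(W)` odd; `K` imaginary quadratic, `d_K` odd, Heegner for `N_W`;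
`Wd = Cd • W^{(d_K)}` a globally minimal model of the twin) this file ASSEMBLES the abstract ladder count (`…RTLadderCount{,Twin}`,
`…RTLadderFrameBookkeeping`), the `Ш`-level genus budget (`…RTRelaxedShaGenusBudget`) and Cassels–Tate squareness
(`GenusExact.CasselsTateNumberField.isSquare_natCard_primaryComponent_sha`, gk2-p1) into:

* §1 the twin side of the budget: `Δ(Wd) < 0`, `Wd` has good reduction at the non-split primes off `d_K`
  (`hasGoodReductionAt_primePlace_twin_of_ncard_ne_two`, conductor of a twist by `d_K ≡ 1 (4)`), and
  **`relIndex_sha_comap_resBaseChange_twin_le_two_pow`: `[res⁻¹(Ш(Wd_K/K)) : Ш(Wd/ℚ)] ≤ 2^{ord₂ C(Wd)}`**, finite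
  (`∏_{q ∣ d_K} #Wd(ℚ_q)[2] = ∏ #W(ℚ_q)[2] = 2^{ord₂ C(Wd)}`, `prod_natCard_twoTorsion_twin_eq_two_pow`);
* §2 **`two_mul_le_padicValNat_add_of_shaLadders` (THE FRAME THEOREM)**: if for every `m < T` there are `2m+2` INDEPENDENT classes
  `x_i ∈ H¹(ℚ, W)` of order `2^{M_{2m} − M_{2m+1}}` whose restrictions to `K` lie in `Ш(W_K/K)`, and `2m+2` independent classes
  `x'_i ∈ H¹(ℚ, Wd)` of order `2^{M_{2m+1} − M_{2m+2}}` with restrictions in `Ш(Wd_K/K)` (the (+)- and (−)-ladders of McCallum's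
  classes `d_{M_{r−1}}(n)` at odd / even depth `r`, Prop. 5.2 over `ℚ` at `2`), for an antitone ladder `M` with `M_{2T} = 0`, then
  `2·M₀ ≤ ord₂ #Ш(W/ℚ)[2^∞] + ord₂ #Ш(Wd/ℚ)[2^∞] + 4⌊ord₂ C(Wd)/2⌋`;
  **`twinLadderGenus_ineq_of_shaLadders_of_padicValNat_eq_one`**: on the part of the frame with `ord₂ C(Wd) = 1` (one transposition
  prime in `d_K`, the pen's 219/262 instrument rows) this is EXACTLY 3a‴'s inequality
  `2·M₀ ≤ ord₂ g + ord₂ g′ + ord₂ C(Wd) − 1`.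
So on `ord₂ C(Wd) = 1` the stub 3a‴ is reduced to the existence of the two ladders (McCallum Prop. 5.2 over `ℚ` at `2` for `W`
and for `Wd`: Q2 `KolyvaginRelationAtTwo` + Q5R `EquivariantChebotarevAtTwoR` + Poitou–Tate reciprocity); for `ord₂ C(Wd) ≥ 3`
the joint accounting of the two genus losses (`β₁ + β₂` vs `ord₂ C(Wd) − 1`) remains.

References: [McCallumLMS1991] §5 (Prop. 5.2, Thm. 5.4, Cor. 5.6); [Kramer1981] §2 Prop. 3, Thm. 1; [GrossLMS1991] Prop. 5.4, §6;
[SilvermanAEC2009] X.4.14 (Cassels–Tate), III.3.1(b); [SilvermanATAEC1994] IV.9.4, IV.10.2.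
-/

set_option autoImplicit false
-- the Theorems namespace of this sub repeats the summit name by design (D-0017 nested layout)
set_option linter.dupNamespace false

noncomputable section

open scoped Classical

namespace Summit.BirchSwinnertonDyer.BirchSwinnertonDyer.Theorems.GenusExact.PlusDescent

open WeierstrassCurve NumberField IsDedekindDomain Rat.HeightOneSpectrum Literature.NumberTheory.EllipticCurves
  Literature.Barriers.BirchSwinnertonDyer

/-! ## §1 The twin side of the `Ш`-level budget -/

section TwinSide

variable (W : WeierstrassCurve ℚ) [W.IsElliptic] (K : Type) [Field K] [NumberField K]
  {Wd : WeierstrassCurve ℚ} [Wd.IsElliptic]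

omit [W.IsElliptic] [Wd.IsElliptic] in
/-- `Δ(Cd • W^{(d)}) < 0` when `Δ(W) < 0` (`Δ(W^{(d)}) = d⁶ Δ(W)`, `Δ(C • X) = u⁻¹² Δ(X)`). [cite: SilvermanAEC2009, III.1 Table 3.1 and X.§5] -/
theorem Δ_twin_neg (hΔ : W.Δ < 0) (Cd : VariableChange ℚ) (hWd : Cd • W.quadraticTwist (NumberField.discr K : ℚ) = Wd) :
    Wd.Δ < 0 := by
  rw [← hWd, variableChange_Δ, quadraticTwist_Δ]
  have hd : (NumberField.discr K : ℚ) ≠ 0 := by exact_mod_cast NumberField.discr_ne_zero K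
  have h1 : (0 : ℚ) < ((Cd.u⁻¹ : ℚˣ) : ℚ) ^ 12 := Even.pow_pos (by norm_num) (Units.ne_zero _)
  have h2 : (0 : ℚ) < (NumberField.discr K : ℚ) ^ 6 := Even.pow_pos (by norm_num) hd
  nlinarith [mul_pos h1 h2, mul_pos (mul_pos h1 h2) (neg_pos.mpr hΔ)]

/-- **The twin has good reduction at every non-split prime off `d_K`** (Heegner for `N_W`, `d_K` odd): for `p ∤ d_K` with
`#{𝔭 ∣ p} ≠ 2`, `p ∤ N_W` (Heegner), hence `p ∤ N_{W^{(d_K)}} = N_{Wd}` (`d_K ≡ 1 (4)`, conductor of a twist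
`dvd_conductorNorm_quadraticTwist_iff_of_one_mod_four`, isomorphism invariance `conductorNorm_smul_rat`), hence good reduction
(`hasGoodReductionAt_of_not_dvd_conductorNorm`). [cite: SilvermanATAEC1994, IV.9.4 and IV.10.2(a)] [cite: GrossLMS1991, §1] -/
theorem hasGoodReductionAt_primePlace_twin_of_ncard_ne_two (h2 : Module.finrank ℚ K = 2) (hodd : Odd (NumberField.discr K))
    (hHe : SatisfiesHeegnerHypothesis (W.conductorNorm ℤ) K) (Cd : VariableChange ℚ)
    (hWd : Cd • W.quadraticTwist (NumberField.discr K : ℚ) = Wd) {p : ℕ} (hp : p.Prime)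
    (hpd : ¬ (p : ℤ) ∣ NumberField.discr K) (hns : ((Ideal.span {(p : ℤ)}).primesOver (𝓞 K)).ncard ≠ 2) :
    Wd.HasGoodReductionAt (Matsuno2009.primePlace p) := by
  haveI := Fact.mk hp
  have hd0 : (NumberField.discr K : ℚ) ≠ 0 := by exact_mod_cast NumberField.discr_ne_zero K
  haveI := W.isElliptic_quadraticTwist hd0
  obtain ⟨k, hk⟩ := discr_eq_four_mul_add_one_of_odd h2 hodd
  have hd4 : NumberField.discr K % 4 = 1 := by omega
  refine hasGoodReductionAt_of_not_dvd_conductorNorm Wd (Matsuno2009.primePlace p) ?_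
  rw [Matsuno2009.primesEquiv_primePlace hp, ← hWd, conductorNorm_smul_rat,
    GenusGrossZagier.dvd_conductorNorm_quadraticTwist_iff_of_one_mod_four W hd4 hpd]
  exact fun h ↦ hns (hHe p hp h)

variable {K} in
/-- **`∏_{q ∣ d_K} #Wd(ℚ_q)[2] = 2^{ord₂ C(Wd)}`** for the twin `Wd = Cd • W^{(d_K)}` of a globally minimal `W` with `C(W)` odd
(twist invariance of local `2`-torsion counts `natCard_twoTorsion_baseChange_twin_eq`, then gk2-p3 g17's
`prod_ncard_roots_add_one_eq_two_pow_padicValNat_tamagawaProduct_twin`). [cite: Kramer1981, §2 Prop. 3 and Thm. 1] -/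
theorem prod_natCard_twoTorsion_twin_eq_two_pow [W.IsGloballyMinimal] (hIQ : IsImaginaryQuadratic K)
    (hodd : Odd (NumberField.discr K)) (hHe : SatisfiesHeegnerHypothesis (W.conductorNorm ℤ) K) (hT : Odd W.tamagawaProduct)
    (Cd : VariableChange ℚ) (hWd : Cd • W.quadraticTwist (NumberField.discr K : ℚ) = Wd) :
    ∏ p ∈ (NumberField.discr K).natAbs.primeFactors,
        Nat.card {P : (Wd.baseChange ((Matsuno2009.primePlace p).adicCompletion ℚ)).toAffine.Point // 2 • P = 0} =
      2 ^ padicValNat 2 Wd.tamagawaProduct := by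
  rw [← prod_ncard_roots_add_one_eq_two_pow_padicValNat_tamagawaProduct_twin W hIQ hodd hHe hT Cd hWd]
  refine Finset.prod_congr rfl fun p hp ↦ ?_
  have hD0 : (NumberField.discr K).natAbs ≠ 0 := Int.natAbs_ne_zero.mpr (NumberField.discr_ne_zero K)
  obtain ⟨hpr, hpdvd, -⟩ := Nat.mem_primeFactors.mp hp
  have hpd : (p : ℤ) ∣ NumberField.discr K := Int.natCast_dvd.mpr hpdvd
  have hp2 : p ≠ 2 := by
    rintro rfl
    obtain ⟨r, hr⟩ := hodd
    omega
  haveI := Fact.mk hpr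
  have hd0 : (NumberField.discr K : ℚ) ≠ 0 := by exact_mod_cast NumberField.discr_ne_zero K
  haveI : CharZero ((Matsuno2009.primePlace p).adicCompletion ℚ) :=
    charZero_of_injective_algebraMap (algebraMap ℚ _).injective
  rw [natCard_twoTorsion_baseChange_twin_eq W Wd hd0 Cd hWd,
    natCard_twoTorsion_adicCompletion_eq_padic W (Matsuno2009.primePlace p) (Matsuno2009.natCast_mem_primePlace hpr)]
  exact GenusKolyTwin.natCard_twoTorsion_padic_eq W hp2
    (not_dvd_minimalDiscriminantInt_of_dvd_discr_of_heegner W K hIQ.1 hHe hpr hp2 hpd)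

variable {K} in
/-- **THE TWIN SIDE OF THE `Ш`-LEVEL GENUS BUDGET: `[res⁻¹(Ш(Wd_K/K)) : Ш(Wd/ℚ)] ≤ 2^{ord₂ C(Wd)}`, finite**, on the LINE 18 frame
(`W` globally minimal with `Δ_W < 0` and `C(W)` odd, `K` imaginary quadratic with odd `d_K` and Heegner for `N_W`, `Wd = Cd • W^{(d_K)}`):
the general budget `relIndex_sha_relaxed_le_prod_natCard_twoTorsion` for `Wd` (good at the non-split primes off `d_K`), the real
condition automatic (`Δ(Wd) < 0`), and `∏ #Wd(ℚ_q)[2] = 2^{ord₂ C(Wd)}`. [cite: Kramer1981, §2 Prop. 3 and Thm. 1]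
[cite: Matsuno2009, Prop. 3.2] -/
theorem relIndex_sha_comap_resBaseChange_twin_le_two_pow [W.IsGloballyMinimal] (hΔ : W.Δ < 0) (hIQ : IsImaginaryQuadratic K)
    (hodd : Odd (NumberField.discr K)) (hHe : SatisfiesHeegnerHypothesis (W.conductorNorm ℤ) K) (hT : Odd W.tamagawaProduct)
    (Cd : VariableChange ℚ) (hWd : Cd • W.quadraticTwist (NumberField.discr K : ℚ) = Wd) :
    (Wd.sha).relIndex (((Wd.baseChange K).sha).comap (resBaseChange Wd K)) ≠ 0 ∧
      (Wd.sha).relIndex (((Wd.baseChange K).sha).comap (resBaseChange Wd K)) ≤ 2 ^ padicValNat 2 Wd.tamagawaProduct := by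
  have hgood : ∀ p : ℕ, p.Prime → ¬ (p : ℤ) ∣ NumberField.discr K →
      ((Ideal.span {(p : ℤ)}).primesOver (𝓞 K)).ncard ≠ 2 → Wd.HasGoodReductionAt (Matsuno2009.primePlace p) :=
    fun _ hp hpd hns ↦ hasGoodReductionAt_primePlace_twin_of_ncard_ne_two W K hIQ.1 hodd hHe Cd hWd hp hpd hns
  have hne := relIndex_sha_relaxed_ne_zero Wd K hIQ.1 hodd hgood
  have hle := relIndex_sha_relaxed_le_prod_natCard_twoTorsion Wd K hIQ.1 hodd hgood
  have hΔd : Wd.Δ < 0 := Δ_twin_neg W K hΔ Cd hWd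
  have harch := comap_resBaseChange_sha_inf_iInf_eq_of_Δ_neg Wd K hΔd
  rw [harch] at hne hle
  exact ⟨hne, hle.trans_eq (prod_natCard_twoTorsion_twin_eq_two_pow W hIQ hodd hHe hT Cd hWd)⟩

end TwinSide

/-! ## §2 The frame theorem -/

section Frame

variable {G : Type*} [AddCommGroup G]

/-- Families in `H¹(ℚ, X)` with restrictions in a subgroup `R` and `2`-power orders lift to independent families in `R[2^∞]`
(bookkeeping for the frame theorem). [folklore] -/
theorem exists_indepFamily_primaryComponent_of_mem {R : AddSubgroup G} {n a : ℕ} (x : Fin n → G)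
    (hmem : ∀ i, x i ∈ R) (hord : ∀ i, addOrderOf (x i) = 2 ^ a)
    (hind : ∀ c : Fin n → ℤ, ∑ i, c i • x i = 0 → ∀ i, ((2 ^ a : ℕ) : ℤ) ∣ c i) :
    ∃ y : Fin n → AddCommGroup.primaryComponent R 2, (∀ i, addOrderOf (y i) = 2 ^ a) ∧
      ∀ c : Fin n → ℤ, ∑ i, c i • y i = 0 → ∀ i, ((2 ^ a : ℕ) : ℤ) ∣ c i := by
  have hmemP : ∀ i, (⟨x i, hmem i⟩ : R) ∈ AddCommGroup.primaryComponent R 2 := fun i ↦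
    (AddCommGroup.mem_primaryComponent).mpr ⟨a, Subtype.ext (by
      have h := addOrderOf_nsmul_eq_zero (x i)
      rw [hord i] at h
      simpa using h)⟩
  let y : Fin n → AddCommGroup.primaryComponent R 2 := fun i ↦ ⟨⟨x i, hmem i⟩, hmemP i⟩
  let j : AddCommGroup.primaryComponent R 2 →+ G := R.subtype.comp (AddCommGroup.primaryComponent R 2).subtype
  have hj : Function.Injective j := R.subtype_injective.comp (AddCommGroup.primaryComponent R 2).subtype_injective
  have hjy : ∀ i, j (y i) = x i := fun _ ↦ rfl
  refine ⟨y, fun i ↦ ?_, fun c hc ↦ ?_⟩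
  · rw [← addOrderOf_injective j hj (y i), hjy, hord]
  · refine hind c ?_
    have h := congrArg j hc
    rw [map_sum, map_zero] at h
    simpa only [map_zsmul, hjy] using h

variable (W : WeierstrassCurve ℚ) [W.IsElliptic] [W.IsGloballyMinimal] (K : Type) [Field K] [NumberField K]
  {Wd : WeierstrassCurve ℚ} [Wd.IsElliptic]

/-- **One side of the frame**: for `X/ℚ` (either `W` or its twin) with `Ш(X/ℚ)[2^∞]` finite of order `g`, and
`[res⁻¹(Ш(X_K/K)) : Ш(X/ℚ)] ≤ 2^B` finite, a ladder of independent families in `H¹(ℚ, X)` with restrictions in `Ш(X_K/K)` gives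
`2 Σ_m e m ≤ ord₂ g + 2⌊B/2⌋` (count + index transfer + Cassels–Tate parity refund). [cite: McCallumLMS1991, §5 Thm. 5.4]
[cite: SilvermanAEC2009, X.4.14] -/
theorem two_mul_sum_le_padicValNat_of_shaLadder (X : WeierstrassCurve ℚ) [X.IsElliptic] {B : ℕ} (T : ℕ) (e : ℕ → ℕ)
    (hg : 0 < Nat.card (AddCommGroup.primaryComponent X.sha 2))
    (hidx : (X.sha).relIndex (((X.baseChange K).sha).comap (resBaseChange X K)) ≠ 0)
    (hle : (X.sha).relIndex (((X.baseChange K).sha).comap (resBaseChange X K)) ≤ 2 ^ B)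
    (hfam : ∀ m < T, ∃ x : Fin (2 * m + 2) → X.galH1, (∀ i, resBaseChange X K (x i) ∈ (X.baseChange K).sha) ∧
      (∀ i, addOrderOf (x i) = 2 ^ e m) ∧
      ∀ c : Fin (2 * m + 2) → ℤ, ∑ i, c i • x i = 0 → ∀ i, ((2 ^ e m : ℕ) : ℤ) ∣ c i) :
    2 * ∑ m ∈ Finset.range T, e m ≤ padicValNat 2 (Nat.card (AddCommGroup.primaryComponent X.sha 2)) + 2 * (B / 2) := by
  set R : AddSubgroup X.galH1 := ((X.baseChange K).sha).comap (resBaseChange X K) with hR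
  have hHR : X.sha ≤ R := fun c hc ↦ AddSubgroup.mem_comap.mpr (resBaseChange_mem_sha X K hc)
  haveI : Finite (AddCommGroup.primaryComponent X.sha 2) := Nat.finite_of_card_ne_zero hg.ne'
  obtain ⟨k, hk, hkdvd, hcard⟩ := exists_natCard_primaryComponent_eq_mul_of_le hHR 2 hidx
  have hkB : k ≤ 2 ^ B := (Nat.le_of_dvd (Nat.pos_of_ne_zero hidx) hkdvd).trans hle
  have heven : Even (padicValNat 2 (Nat.card (AddCommGroup.primaryComponent X.sha 2))) :=
    even_padicValNat_of_isSquare hg.ne' (CasselsTateNumberField.isSquare_natCard_primaryComponent_sha X 2)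
  refine two_mul_sum_le_padicValNat_add_of_ladder_of_dvd_mul_of_even (A := AddCommGroup.primaryComponent R 2) T e hg hk
    hkB (by rw [hcard]) heven fun m hm ↦ ?_
  obtain ⟨x, hres, hord, hind⟩ := hfam m hm
  exact exists_indepFamily_primaryComponent_of_mem x (fun i ↦ AddSubgroup.mem_comap.mpr (hres i)) hord hind

/-- **THE FRAME THEOREM FOR 3a‴.**  On the LINE 18 frame — `W/ℚ` globally minimal elliptic with `Δ_W < 0` and `C(W)` odd; `K`
imaginary quadratic with odd `d_K` satisfying the Heegner hypothesis for `N_W`; `Wd = Cd • W^{(d_K)}` an elliptic model of the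
twin; `Ш(W/ℚ)[2^∞]`, `Ш(Wd/ℚ)[2^∞]` finite (orders `g, g′ > 0`) — let `M` be an antitone ladder with `M_{2T} = 0`, and suppose
that for every `m < T` there are `2m+2` independent classes in `H¹(ℚ, W)` of order `2^{M_{2m} − M_{2m+1}}` restricting into
`Ш(W_K/K)`, and `2m+2` independent classes in `H¹(ℚ, Wd)` of order `2^{M_{2m+1} − M_{2m+2}}` restricting into `Ш(Wd_K/K)` (the
(+)/(−)-descended Kolyvagin classes `d_{M_{r−1}}(n)`, `r` odd/even, of McCallum's Prop. 5.2 over `ℚ` at `2`).  Then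
`2 · M₀ ≤ ord₂ g + ord₂ g′ + 4⌊ord₂ C(Wd)/2⌋`.  (Count `…RTLadderCount{,Twin}` in the groups `res⁻¹(Ш(·_K))[2^∞]`; losses
`≤ ord₂ C(Wd)` per side by the `Ш`-level genus budgets; Cassels–Tate parity refund per side.)
[cite: McCallumLMS1991, §5 Prop. 5.2, Thm. 5.4, Cor. 5.6] [cite: Kramer1981, §2 Prop. 3 and Thm. 1] -/
theorem two_mul_le_padicValNat_add_of_shaLadders (hΔ : W.Δ < 0) (hT : Odd W.tamagawaProduct)
    (hIQ : IsImaginaryQuadratic K) (hodd : Odd (NumberField.discr K)) (hHe : SatisfiesHeegnerHypothesis (W.conductorNorm ℤ) K)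
    (Cd : VariableChange ℚ) (hWd : Cd • W.quadraticTwist (NumberField.discr K : ℚ) = Wd)
    (hg : 0 < Nat.card (AddCommGroup.primaryComponent W.sha 2)) (hg' : 0 < Nat.card (AddCommGroup.primaryComponent Wd.sha 2))
    (T : ℕ) (M : ℕ → ℕ) (hM : ∀ j, M (j + 1) ≤ M j) (hMT : M (2 * T) = 0)
    (hfam : ∀ m < T, ∃ x : Fin (2 * m + 2) → W.galH1, (∀ i, resBaseChange W K (x i) ∈ (W.baseChange K).sha) ∧
      (∀ i, addOrderOf (x i) = 2 ^ (M (2 * m) - M (2 * m + 1))) ∧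
      ∀ c : Fin (2 * m + 2) → ℤ, ∑ i, c i • x i = 0 → ∀ i, ((2 ^ (M (2 * m) - M (2 * m + 1)) : ℕ) : ℤ) ∣ c i)
    (hfam' : ∀ m < T, ∃ x : Fin (2 * m + 2) → Wd.galH1, (∀ i, resBaseChange Wd K (x i) ∈ (Wd.baseChange K).sha) ∧
      (∀ i, addOrderOf (x i) = 2 ^ (M (2 * m + 1) - M (2 * m + 2))) ∧
      ∀ c : Fin (2 * m + 2) → ℤ, ∑ i, c i • x i = 0 → ∀ i, ((2 ^ (M (2 * m + 1) - M (2 * m + 2)) : ℕ) : ℤ) ∣ c i) :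
    2 * M 0 ≤ padicValNat 2 (Nat.card (AddCommGroup.primaryComponent W.sha 2)) +
      padicValNat 2 (Nat.card (AddCommGroup.primaryComponent Wd.sha 2)) +
      2 * (padicValNat 2 Wd.tamagawaProduct / 2) + 2 * (padicValNat 2 Wd.tamagawaProduct / 2) := by
  -- the two `Ш`-level budgets
  obtain ⟨hne₁, hle₁⟩ :=
    relIndex_sha_comap_resBaseChange_le_two_pow_padicValNat_tamagawaProduct_twin_of_Δ_neg W K hΔ hIQ hodd hHe hT Cd hWd
  obtain ⟨hne₂, hle₂⟩ := relIndex_sha_comap_resBaseChange_twin_le_two_pow W hΔ hIQ hodd hHe hT Cd hWd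
  -- the two one-sided counts
  have h₁ := two_mul_sum_le_padicValNat_of_shaLadder K W T (fun m ↦ M (2 * m) - M (2 * m + 1)) hg hne₁ hle₁ hfam
  have h₂ := two_mul_sum_le_padicValNat_of_shaLadder K Wd T (fun m ↦ M (2 * m + 1) - M (2 * m + 2)) hg' hne₂ hle₂ hfam'
  have hsum : 2 * ∑ m ∈ Finset.range T, (M (2 * m) - M (2 * m + 1)) +
      2 * ∑ m ∈ Finset.range T, (M (2 * m + 1) - M (2 * m + 2)) =
      2 * ∑ j ∈ Finset.range (2 * T), (M j - M (j + 1)) := by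
    rw [sum_range_two_mul (fun j => M j - M (j + 1)), ← mul_add, ← Finset.sum_add_distrib]
  rw [sum_range_sub_eq_of_antitone M hM, hMT, Nat.sub_zero] at hsum
  omega

/-- **3a‴ ON `ord₂ C(Wd) = 1`, MODULO THE TWO LADDERS.**  Same frame and ladders as `two_mul_le_padicValNat_add_of_shaLadders`, with
`ord₂ C(Wd) = 1` (exactly one transposition prime `q ∣ d_K`, `Ẽ(𝔽_q)[2] ≅ ℤ/2` — 219 of the pen's 262 instrument rows): then
`2·M₀ ≤ ord₂ g + ord₂ g′ + ord₂ C(Wd) − 1`, the inequality of the registered stub `stub_twinLadderGenus` verbatim in its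
conclusion.  What 3a‴ still needs here is ONLY the two ladders (McCallum Prop. 5.2 over `ℚ` at `2` for `W` and for `Wd`).
[cite: McCallumLMS1991, §5 Prop. 5.2, Thm. 5.4, Cor. 5.6] [cite: Kramer1981, §2 Prop. 3 and Thm. 1] -/
theorem twinLadderGenus_ineq_of_shaLadders_of_padicValNat_eq_one (hΔ : W.Δ < 0) (hT : Odd W.tamagawaProduct)
    (hIQ : IsImaginaryQuadratic K) (hodd : Odd (NumberField.discr K)) (hHe : SatisfiesHeegnerHypothesis (W.conductorNorm ℤ) K)
    (Cd : VariableChange ℚ) (hWd : Cd • W.quadraticTwist (NumberField.discr K : ℚ) = Wd)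
    (hB : padicValNat 2 Wd.tamagawaProduct = 1)
    (hg : 0 < Nat.card (AddCommGroup.primaryComponent W.sha 2)) (hg' : 0 < Nat.card (AddCommGroup.primaryComponent Wd.sha 2))
    (T : ℕ) (M : ℕ → ℕ) (hM : ∀ j, M (j + 1) ≤ M j) (hMT : M (2 * T) = 0)
    (hfam : ∀ m < T, ∃ x : Fin (2 * m + 2) → W.galH1, (∀ i, resBaseChange W K (x i) ∈ (W.baseChange K).sha) ∧
      (∀ i, addOrderOf (x i) = 2 ^ (M (2 * m) - M (2 * m + 1))) ∧
      ∀ c : Fin (2 * m + 2) → ℤ, ∑ i, c i • x i = 0 → ∀ i, ((2 ^ (M (2 * m) - M (2 * m + 1)) : ℕ) : ℤ) ∣ c i)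
    (hfam' : ∀ m < T, ∃ x : Fin (2 * m + 2) → Wd.galH1, (∀ i, resBaseChange Wd K (x i) ∈ (Wd.baseChange K).sha) ∧
      (∀ i, addOrderOf (x i) = 2 ^ (M (2 * m + 1) - M (2 * m + 2))) ∧
      ∀ c : Fin (2 * m + 2) → ℤ, ∑ i, c i • x i = 0 → ∀ i, ((2 ^ (M (2 * m + 1) - M (2 * m + 2)) : ℕ) : ℤ) ∣ c i) :
    (2 * M 0 : ℤ) ≤ (padicValNat 2 (Nat.card (AddCommGroup.primaryComponent W.sha 2)) : ℤ) +
      (padicValNat 2 (Nat.card (AddCommGroup.primaryComponent Wd.sha 2)) : ℤ) +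
      (padicValNat 2 Wd.tamagawaProduct : ℤ) - 1 := by
  have h := two_mul_le_padicValNat_add_of_shaLadders W K hΔ hT hIQ hodd hHe Cd hWd hg hg' T M hM hMT hfam hfam'
  rw [hB] at h
  set a := padicValNat 2 (Nat.card (AddCommGroup.primaryComponent W.sha 2)) with ha
  set b := padicValNat 2 (Nat.card (AddCommGroup.primaryComponent Wd.sha 2)) with hb
  rw [hB]
  push_cast
  omega

end Frame

end Summit.BirchSwinnertonDyer.BirchSwinnertonDyer.Theorems.GenusExact.PlusDescent

end
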